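import Literature.AlgebraicGeometry.Milne1999.LefschetzCentraliser
import Literature.AlgebraicGeometry.HodgeTheory.ExteriorPullback
import HarnessLib

/-!
# Milne 1999, Theorem 4.4, the inclusion `ker l(A) ⊆ S(A)` read on `H¹`: the special Lefschetz group commutes with `End(A)` and preserves the polarization pairing (PROVED)

Family `hodge`, layer `Literature/AlgebraicGeometry/Milne1999`, namespace
`Literature.AlgebraicGeometry.Milne1999` (D-0022). Theorems only (no definition, no named fact, D-0026);
written for the cell `pub-hodgecm2` (COR-CM, Hodge ladder stage 2), binder table `HOME/lit/milne.md`, as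
the PROVED half of the cited record `Milne1999_thm44_specialLefschetzGroup_one_eq_unitaryCentralizerGroup`
of `Milne1999/LefschetzCentraliser` (which asserts the EQUALITY
`{g₁ | g ∈ specialLefschetzGroup (dim A) A.X} = unitaryCentralizerGroup A h`).

## Source read (held text `paper:doi-10-1215-s0012-7094-99-09620-5` = J. S. Milne, *Lefschetz classes on abelian varieties*, Duke Math. J. 96 (1999) 639–675, author version 1999aP), verbatim

* §4, p. 659 (held p0021 L3–L24): "Definition 4.3. The Lefschetz group `L(A)` of an abelian variety `A`
  over `Ω` is the largest algebraic subgroup of `GL(V(A)) × 𝔾_m/k` fixing the elements of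
  `D^s_hom(A^r)_k ⊂ H^{2s}(A^r)(s)` for all `r, s`. Let `G(A)` be the algebraic subgroup of `GL(V(A))` such
  that `G(A)(R) = {γ ∈ C(A) ⊗ R | γ†γ ∈ R^×}` for any `k`-algebra `R`. Thus, for any ample divisor `D` on
  `A`, `G(A)` is the largest algebraic subgroup of `GSp(E^D)` commuting with the endomorphisms of `A`.
  **Theorem 4.4.** The map `γ ↦ (γ, γ†γ) : G(A) → GL(V(A)) × 𝔾_m` sends `G(A)` isomorphically onto
  `L(A)`. Proof. For any `γ ∈ G(A)(k)` and divisor `D` on `A`, `e_D(γx, γy) = e_D(x, γ†γx) = γ†γ · e_D(x, y)`,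
  all `x, y ∈ V(A)`, and so `(γ, γ†γ)` fixes `e_D`. It therefore fixes the class of `D` in `H²(A)(1)`. More
  generally, any `γ ∈ G(A)(k^al)` will fix all divisor classes on `A^r`, all `r`. This shows that
  `G(A) ⊂ L(A)`. For the converse, note that Theorem 3.2 implies that `H^{2*}(A^r)(*)^{G(A)} = D_hom(A^r)_k`
  for all `r`, and so a variant of Chevalley's theorem (Deligne 1982, 3.1) implies that `L(A) = G(A)`."
* ibid. (p0021 L28–L30): "The projection map `GL(V(A)) × 𝔾_m → 𝔾_m` defines a cocharacter of `L(A)`,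
  which we denote `l(A)` (or just `l`). The theorem shows that the kernel of `l(A)`, regarded as a
  subgroup of `GL(V(A))`, equals `S(A)`."
* §1, p. 644 (p0006 L16–L20): "**The group `S(A)`.** […] `S(A)(R) = {γ ∈ C(A) ⊗_k R | γ†γ = 1}`. Thus,
  for any ample divisor `D` on `A`, `S(A)` is the largest algebraic subgroup of `Sp(e_D)` whose elements
  commute with the endomorphisms of `A`."

## What is proved (the tree's carriers; `ℂ`-points, read on `H¹`)

In the rendering of `Milne1999/LefschetzGroup` and `Milne1999/LefschetzCentraliser`:
`specialLefschetzGroup (dim A) A.X ≤ ∏ₖ GL(Hᵏ(A(ℂ); ℂ))` is `ker l(A)(ℂ)` — the families `g = (g_k)`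
admitting a Künneth family `G` on the powers `A^{×(a+1)}` (`IsKunnethFamily`, `G₀ = g`) which FIXES every
Lefschetz class `D^p_hom(A^{a+1})_ℂ = divisorClassesSpan` (the `ℂ`-span of products of rational
`(1,1)`-classes) on every power — and `unitaryCentralizerGroup A h ≤ GL(H¹(A(ℂ); ℂ))` is `S(A)(ℂ)`: the
automorphisms `u` of `H¹` commuting with every `φ^*`, `φ ∈ End(A)`, and preserving the polarization pairing
`Q_h(x, y) = h^{dim A - 1} ∪ x ∪ y` (`Motives.polarizationPairingOne`), `h` the class of an ample divisor.

* `apply_one_mem_unitaryCentralizerGroup_of_mem_specialLefschetzGroup`,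
  **`specialLefschetzGroup_map_one_le_unitaryCentralizerGroup`** — for every complex abelian variety `A`,
  every rational `h ∈ H²(A(ℂ); ℂ)` with `s · h` Kähler for some real `s > 0`, and every
  `g ∈ specialLefschetzGroup (dim A) A.X`: **`g₁ ∈ unitaryCentralizerGroup A h`**, i.e.
  `{g₁ | g ∈ ker l(A)(ℂ)} ≤ S(A)(ℂ)` — the inclusion of Thm. 4.4 / p. 659 that Milne derives "for the
  converse" from Thm. 3.2 (invariant theory) and Chevalley's theorem, here PROVED for Betti cohomology of
  complex abelian varieties;
* `specialLefschetzGroup_map_one_le_centralizerGroup` — unconditionally (no `h` displayed; the rational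
  Kähler class of a projective embedding, `KaehlerRationalDatum`, serves): `g₁` commutes with every `φ^*`.

## The proof (degree-two Lefschetz classes only; no Thm. 3.2, no graph classes, no Néron–Severi dictionary)

Let `g ∈ specialLefschetzGroup (dim A) A.X` with Künneth family `G`, `n = dim A ≥ 1` (for `n = 0`, `H¹ = 0`).
Write `h = Σ_l a_l · u_l ∪ v_l` with `u_l, v_l ∈ H¹(A(ℂ); ℂ)` (`H² = ⋀²H¹`, the tree's
`abelianVarietyCohomologyExteriorH1_holds`).
1. (`sum_cross_apply_eq_sum_cross`) For `φ ∈ End(A)` let `F_φ = pr₁ ≫ φ + pr₂ : A × A → A`, so that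
   `F_φ^* = pr₁^*φ^* + pr₂^*` on `H¹` (Lange–Birkenhake §1.1; the tree's `complexBetti_map_add_one`). Then
   `M_φ := F_φ^*h - pr₁^*φ^*h - pr₂^*h = Σ_l a_l (pr₁^*φ^*u_l ∪ pr₂^*v_l - pr₁^*φ^*v_l ∪ pr₂^*u_l)` in
   `H²((A × A)(ℂ); ℂ)` (for `φ = 𝟙` this is the class of `m^*L ⊗ pr₁^*L⁻¹ ⊗ pr₂^*L⁻¹`, the alternating
   form `E = c₁(L)` of Lange–Birkenhake Thm. 1.2.4 placed on `H¹ ⊗ H¹ ⊆ H²(A × A)`). The three terms are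
   pull-backs of the rational `(1,1)`-class `h` along morphisms of smooth projective varieties, hence
   rational `(1,1)`-classes of `A × A = A^{×2}`, hence LEFSCHETZ classes of the power (`D¹ = B¹`, the tree's
   `mem_divisorClassesSpan_one`), hence fixed by `G₁`; and `G₁(pr₁^*x ∪ pr₂^*y) = pr₁^*g₁x ∪ pr₂^*g₁y`.
2. (`apply_map_contraction_eq`) Comparing Künneth coefficients (Hatcher Thm. 3.16; the tree's
   `HodgeGroupExterior.sum_smul_eq_of_sum_cross_eq`) against a functional `λ` on the second factor:
   `g₁ φ^* w(λ ∘ g₁) = φ^* w(λ)` with the contraction vectors `w(λ) = Σ_l a_l (λ(v_l) u_l - λ(u_l) v_l)`;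
   with `φ = 𝟙` this gives `g₁ φ^* g₁⁻¹ = φ^*` on every `w(λ)`.
3. (`exists_contraction_eq`, `dual_eq_zero_of_contraction_eq_zero`) The `w(λ)` exhaust `H¹`: if
   `w(λ) = 0` with `λ ≠ 0`, the rank-one projection `P = id - λ ⊗ t` (`λ(t) = 1`) onto `ker λ` satisfies
   `⋀²P (h) = h - w(λ) ∪ t = h`, so the multiplicative exterior action `⋀•P` on `H• = ⋀•H¹` (the tree's
   `exteriorPullback`) fixes `h^n ≠ 0` (`s · h` Kähler, Voisin I Cor. 3.9, the tree's
   `IsKaehlerClass.cupPowTwo_ne_zero`), while on the top degree `H^{2n} = ⋀^{2n}H¹` it is multiplication by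
   `det P = 0` (`exteriorPullback_top`) — contradiction; a linear injection `Dual H¹ → H¹` is onto.
   Hence `g₁ φ^* = φ^* g₁`.
4. (`sum_smul_cupProduct_apply_apply_eq`) Pulling the identity of step 1 for `φ = 𝟙` back along the
   diagonal gives `Σ_l a_l · g₁u_l ∪ g₁v_l = h`, i.e. `⋀²g₁` fixes `h`; so `⋀•g₁` fixes `h^{n-1}` and
   `h^n ≠ 0`, whence `det g₁ = 1`, and `Q_h(g₁x, g₁y) = ⋀^{2n}g₁ (h^{n-1} ∪ x ∪ y) = det g₁ · Q_h(x, y)`.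

## What is NOT here

* The reverse inclusion `S(A)(ℂ) ≤ {g₁ | g ∈ specialLefschetzGroup}` (Milne's "any `γ ∈ G(A)(k^al)` will
  fix all divisor classes on `A^r`, all `r`. This shows that `G(A) ⊂ L(A)`"): it needs, on the carriers,
  the construction of the Künneth family `⋀•(u ⊕ ⋯ ⊕ u)` on all powers and the description of the rational
  `(1,1)`-classes of `A^r` through `End⁰(A^r)` (Néron–Severi ↔ Rosati-symmetric endomorphisms); it stays
  inside the cited record `Milne1999_thm44_specialLefschetzGroup_one_eq_unitaryCentralizerGroup`.
* Milne's algebraic groups over `k` and arbitrary Weil cohomologies; only `ℂ`-points and Betti cohomology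
  of complex abelian varieties occur (the convention of `HodgeTheory/MotivatedGaloisGroup`).

## References

* [Milne1999LefschetzClasses] J. S. Milne, Lefschetz classes on abelian varieties, Duke Math. J. 96
  (1999) 639–675: §1 p. 644 (`S(A)`), §4 Def. 4.3, Thm. 4.4 with proof, p. 659 (`ker l(A) = S(A)`).
* [LangeBirkenhake1992] H. Lange, Ch. Birkenhake, Complex Abelian Varieties, §1.1 (p. 19: `f ↦ ρ_r(f)`
  additive), Lemma 1.1.17 and Exercise 1.1.6 (7) (`H• = ⋀•H¹`), Thm. 1.2.4 (`c₁(L)` as an alternating form).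
* [HatcherAT2002] A. Hatcher, Algebraic Topology (2002), §3.2 Prop. 3.10 (`f^*` multiplicative), Thm. 3.11
  (graded commutativity), Thm. 3.16 (Künneth).
* [VoisinHodgeI2002] C. Voisin, Hodge Theory and Complex Algebraic Geometry I (2002), §3.1.3 Cor. 3.9
  (`[ω]ⁿ ≠ 0`), §6.2.3 (Lefschetz operator), §7.1.2 (Kähler classes of type `(1,1)`).
* [vanGeemen1994HodgeAV] B. van Geemen, An introduction to the Hodge conjecture for abelian varieties,
  LNM 1594 (1994), §2.4 (`D¹ = B¹`).
* [Andre1996Motifs] Y. André, Pour une théorie inconditionnelle des motifs, Publ. Math. IHÉS 83 (1996),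
  §4.3 (diagonal action on `H(X) ⊗ H(X)`).
-/

noncomputable section

open CategoryTheory MonoidalCategory CartesianMonoidalCategory
open Literature.AlgebraicTopology.SingularHomology
open Literature.AlgebraicGeometry.HodgeTheory
open Literature.AlgebraicGeometry.Motives
open Literature.AlgebraicGeometry.VanGeemen1994 (pullbackOne)
open Literature.Barriers.HodgeConjecture (divisorClassesSpan)
open Literature.Geometry.Kaehler (lefschetzPow lefschetzOperator lefschetzPow_succ lefschetzPow_zero
  lefschetzOperator_apply)

namespace Literature.AlgebraicGeometry.Milne1999

/-! ### Top-degree alternating maps are multiples of the determinant -/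

section LinearAlgebra

variable {K V N ι : Type*} [Field K] [AddCommGroup V] [Module K V] [AddCommGroup N] [Module K N]
  [Fintype ι] [DecidableEq ι]

/-- An alternating map in as many arguments as a basis has vectors takes the value
`det_b(v) • f(b)` at every family `v` (`f = f(b) • det_b`, the vector-valued form of Mathlib's
`AlternatingMap.eq_smul_basis_det`). [folklore] -/
private theorem alternatingMap_apply_eq_basis_det_smul (f : V [⋀^ι]→ₗ[K] N) (b : Module.Basis ι K V)
    (v : ι → V) : f v = b.det v • f b := by
  rw [← sub_eq_zero, ← Module.forall_dual_apply_eq_zero_iff K]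
  intro lam
  have h := congrFun (congrArg DFunLike.coe ((lam.compAlternatingMap f).eq_smul_basis_det b)) v
  simp only [LinearMap.compAlternatingMap_apply, AlternatingMap.smul_apply, smul_eq_mul] at h
  rw [map_sub, map_smul, h, smul_eq_mul, mul_comm, sub_self]

/-- Transforming the arguments of a top-degree alternating map by an endomorphism `r` multiplies the
value by `det r`. [folklore] -/
private theorem alternatingMap_apply_comp_eq_det_smul (f : V [⋀^ι]→ₗ[K] N) (b : Module.Basis ι K V)
    (r : V →ₗ[K] V) (v : ι → V) : f (fun i ↦ r (v i)) = LinearMap.det r • f v := by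
  rw [alternatingMap_apply_eq_basis_det_smul f b (fun i ↦ r (v i)),
    alternatingMap_apply_eq_basis_det_smul f b v, smul_smul,
    show (fun i ↦ r (v i)) = ⇑r ∘ v from rfl, Module.Basis.det_comp]

end LinearAlgebra

/-! ### The exterior action `⋀•L` of an endomorphism `L` of `H¹(A(ℂ); ℂ)` on `H•(A(ℂ); ℂ) = ⋀•H¹` -/

section ExteriorAction

variable (A : AbelianVariety ℂ) (hΛ : HasExteriorCohomologyH1 ℂ (ComplexPoints A.X))
  (L : complexBetti A.X 1 →ₗ[ℂ] complexBetti A.X 1)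

/-- `⋀¹L = L` on `H¹`. [cite: LangeBirkenhake1992, Lemma 1.1.17 and Exercise 1.1.6 (7)] -/
theorem exteriorPullback_deg_one (x : complexBetti A.X 1) : exteriorPullback hΛ L 1 x = L x := by
  have h := exteriorPullback_cupPowOne hΛ L 1 (fun _ ↦ x)
  rwa [cupPowOne_one, cupPowOne_one] at h

/-- `⋀²L (x ∪ y) = L x ∪ L y`. [cite: LangeBirkenhake1992, Lemma 1.1.17] -/
theorem exteriorPullback_cupProduct_one_one (x y : complexBetti A.X 1) :
    exteriorPullback hΛ L 2 (cupProduct (rfl : 1 + 1 = 2) x y) =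
      cupProduct (rfl : 1 + 1 = 2) (L x) (L y) := by
  rw [exteriorPullback_cupProduct, exteriorPullback_deg_one, exteriorPullback_deg_one]

variable {A L} in
/-- If `⋀²L` fixes `κ ∈ H²` then `⋀L` fixes every cup power `κⁱ`. [cite: HatcherAT2002, §3.2 Prop. 3.10] -/
theorem exteriorPullback_cupPowTwo {κ : complexBetti A.X 2} (hκ : exteriorPullback hΛ L 2 κ = κ) :
    ∀ i : ℕ, exteriorPullback hΛ L (2 * i) (cupPowTwo κ i) = cupPowTwo κ i
  | 0 => by
    rw [cupPowTwo_zero]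
    exact exteriorPullback_one hΛ L
  | i + 1 => by
    rw [cupPowTwo_succ, exteriorPullback_cupProduct, exteriorPullback_cupPowTwo hκ i, hκ]

variable {A L} in
/-- If `⋀²L` fixes `κ ∈ H²` then `⋀L` commutes with the Lefschetz iterates `Lʲ_κ = (κ ∪ -)ʲ`.
[cite: VoisinHodgeI2002, §6.2.3] -/
theorem exteriorPullback_lefschetzPow {κ : complexBetti A.X 2} (hκ : exteriorPullback hΛ L 2 κ = κ)
    (k : ℕ) (a : complexBetti A.X k) :
    ∀ j : ℕ, exteriorPullback hΛ L (k + 2 * j) (lefschetzPow κ j k a) =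
      lefschetzPow κ j k (exteriorPullback hΛ L k a)
  | 0 => rfl
  | j + 1 => by
    rw [lefschetzPow_succ, LinearMap.comp_apply, LinearMap.comp_apply, lefschetzOperator_apply,
      lefschetzOperator_apply, exteriorPullback_cupProduct, hκ, exteriorPullback_lefschetzPow hκ k a j]

variable {A} in
/-- **In top degree `2 dim A = dim H¹(A(ℂ); ℂ)`, `⋀L` is multiplication by `det L`** (the top
exterior power of an endomorphism is its determinant; `H^{2g}(A(ℂ); ℂ) = ⋀^{2g} H¹`).
[cite: LangeBirkenhake1992, Lemma 1.1.17 and Exercise 1.1.6 (7)–(8)] -/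
theorem exteriorPullback_top {d : ℕ} (hd : Module.finrank ℂ (complexBetti A.X 1) = d)
    (z : complexBetti A.X d) : exteriorPullback hΛ L d z = LinearMap.det L • z := by
  classical
  haveI : Module.Finite ℂ (complexBetti A.X 1) := abelianVarietyCohomologyExteriorH1_holds.finite_one A
  let b := Module.finBasisOfFinrankEq ℂ (complexBetti A.X 1) hd
  have key : exteriorPullback hΛ L d =
      LinearMap.det L • (LinearMap.id : complexBetti A.X d →ₗ[ℂ] complexBetti A.X d) := by
    refine exteriorPullback_ext hΛ fun v ↦ ?_
    rw [exteriorPullback_cupPowOne, LinearMap.smul_apply, LinearMap.id_apply, ← cupPowOneAlt_apply,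
      ← cupPowOneAlt_apply]
    exact alternatingMap_apply_comp_eq_det_smul (cupPowOneAlt ℂ (ComplexPoints A.X) d) b L v
  rw [key, LinearMap.smul_apply, LinearMap.id_apply]

end ExteriorAction

/-! ### The contraction vectors `w(λ) = Σ_l a_l (λ(v_l) u_l - λ(u_l) v_l)` of `h = Σ_l a_l u_l ∪ v_l` span `H¹` when `h^{dim A} ≠ 0` -/

section Nondegenerate

variable {A : AbelianVariety ℂ} {ι : Type} [Fintype ι]

/-- Cup product of two classes corrected along a rank-one projection `x ↦ x - λ(x) t`:
`(u - λ(u)t) ∪ (v - λ(v)t) = u ∪ v - (λ(v)u - λ(u)v) ∪ t` (`t ∪ t = 0`, `t ∪ v = -v ∪ t` in degree one).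
[cite: HatcherAT2002, §3.2 Thm. 3.11] -/
theorem cupProduct_sub_smul_sub_smul (lam : Module.Dual ℂ (complexBetti A.X 1))
    (t u v : complexBetti A.X 1) :
    cupProduct (rfl : 1 + 1 = 2) (u - lam u • t) (v - lam v • t) =
      cupProduct (rfl : 1 + 1 = 2) u v -
        cupProduct (rfl : 1 + 1 = 2) (lam v • u - lam u • v) t := by
  have htt : cupProduct (rfl : 1 + 1 = 2) t t = 0 := cup_self_deg_one t
  have htv : cupProduct (rfl : 1 + 1 = 2) t v = -cupProduct (rfl : 1 + 1 = 2) v t := by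
    rw [cupProduct_gradedComm_holds ℂ (ComplexPoints A.X) (rfl : 1 + 1 = 2) rfl t v]
    simp
  simp only [map_sub, map_smul, LinearMap.sub_apply, LinearMap.smul_apply, htt, htv, smul_zero,
    sub_zero, smul_neg, sub_neg_eq_add]
  module

/-- The exterior action of the projection `P = id - λ ⊗ t` fixes `h = Σ_l a_l u_l ∪ v_l` as soon as the
contraction `w(λ) = Σ_l a_l (λ(v_l) u_l - λ(u_l) v_l)` vanishes: `⋀²P h = h - w(λ) ∪ t`.
[cite: HatcherAT2002, §3.2 Prop. 3.10 and Thm. 3.11] -/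
theorem exteriorPullback_proj_apply_eq (hΛ : HasExteriorCohomologyH1 ℂ (ComplexPoints A.X))
    (lam : Module.Dual ℂ (complexBetti A.X 1)) (t : complexBetti A.X 1)
    (a : ι → ℂ) (u v : ι → complexBetti A.X 1)
    (hw : ∑ l, a l • (lam (v l) • u l - lam (u l) • v l) = 0) :
    exteriorPullback hΛ (LinearMap.id - lam.smulRight t) 2
        (∑ l, a l • cupProduct (rfl : 1 + 1 = 2) (u l) (v l)) =
      ∑ l, a l • cupProduct (rfl : 1 + 1 = 2) (u l) (v l) := by
  have hP : ∀ x, (LinearMap.id - lam.smulRight t : complexBetti A.X 1 →ₗ[ℂ] complexBetti A.X 1) x =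
      x - lam x • t := fun x ↦ rfl
  rw [map_sum]
  simp_rw [map_smul, exteriorPullback_cupProduct_one_one, hP, cupProduct_sub_smul_sub_smul, smul_sub,
    Finset.sum_sub_distrib]
  rw [sub_eq_self]
  calc ∑ l, a l • cupProduct (rfl : 1 + 1 = 2) (lam (v l) • u l - lam (u l) • v l) t
      = cupProduct (rfl : 1 + 1 = 2) (∑ l, a l • (lam (v l) • u l - lam (u l) • v l)) t := by
        rw [map_sum, LinearMap.sum_apply]
        refine Finset.sum_congr rfl fun l _ ↦ ?_
        rw [map_smul, LinearMap.smul_apply]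
    _ = 0 := by rw [hw, map_zero, LinearMap.zero_apply]

/-- The rank-one projection `P = id - λ ⊗ t` with `λ(t) = 1` kills `t ≠ 0`, so `det P = 0`. [folklore] -/
private theorem det_id_sub_smulRight_eq_zero (lam : Module.Dual ℂ (complexBetti A.X 1))
    {t : complexBetti A.X 1} (ht : lam t = 1) :
    LinearMap.det (LinearMap.id - lam.smulRight t : complexBetti A.X 1 →ₗ[ℂ] complexBetti A.X 1) = 0 := by
  haveI : Module.Finite ℂ (complexBetti A.X 1) := abelianVarietyCohomologyExteriorH1_holds.finite_one A
  rw [LinearMap.det_eq_zero_iff_ker_ne_bot]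
  intro hker
  have h0 : (LinearMap.id - lam.smulRight t : complexBetti A.X 1 →ₗ[ℂ] complexBetti A.X 1) t = 0 := by
    rw [LinearMap.sub_apply, LinearMap.id_apply, LinearMap.smulRight_apply, ht, one_smul, sub_self]
  have ht0 : t = 0 := by
    rw [← LinearMap.mem_ker, hker, Submodule.mem_bot] at h0
    exact h0
  rw [ht0, map_zero] at ht
  exact zero_ne_one ht

/-- **Non-degeneracy of `h` as a `2`-vector**: if `h = Σ_l a_l u_l ∪ v_l` has `h^{dim A} ≠ 0` (e.g. `h` is
a non-zero multiple of a Kähler class), then no non-zero functional `λ` on `H¹(A(ℂ); ℂ)` has vanishing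
contraction `w(λ) = Σ_l a_l (λ(v_l) u_l - λ(u_l) v_l)` — otherwise the projection `P` onto `ker λ` would
fix `h`, hence `h^{dim A}`, while acting on the top degree by `det P = 0`. (The symplectic form of an
ample class is non-degenerate, Lange–Birkenhake §2.5; here from `vol ≠ 0` alone.)
[cite: LangeBirkenhake1992, §2.5 and Lemma 1.1.17] [cite: VoisinHodgeI2002, §3.1.3 Cor. 3.9] -/
theorem dual_eq_zero_of_contraction_eq_zero (a : ι → ℂ) (u v : ι → complexBetti A.X 1)
    (hpow : cupPowTwo (∑ l, a l • cupProduct (rfl : 1 + 1 = 2) (u l) (v l)) A.dim ≠ 0)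
    (lam : Module.Dual ℂ (complexBetti A.X 1))
    (hw : ∑ l, a l • (lam (v l) • u l - lam (u l) • v l) = 0) : lam = 0 := by
  by_contra hlam
  obtain ⟨t₀, ht₀⟩ : ∃ t, lam t ≠ 0 := by
    by_contra hall
    push Not at hall
    exact hlam (LinearMap.ext hall)
  set t : complexBetti A.X 1 := (lam t₀)⁻¹ • t₀ with ht_def
  have ht : lam t = 1 := by rw [ht_def, map_smul, smul_eq_mul, inv_mul_cancel₀ ht₀]
  have h2 := exteriorPullback_proj_apply_eq (AbelianVariety.hasExteriorCohomologyH1_complexPoints A)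
    lam t a u v hw
  have hfix := exteriorPullback_cupPowTwo (AbelianVariety.hasExteriorCohomologyH1_complexPoints A) h2 A.dim
  rw [exteriorPullback_top (AbelianVariety.hasExteriorCohomologyH1_complexPoints A) _
    (AbelianVariety.finrank_complexBetti_one A), det_id_sub_smulRight_eq_zero lam ht, zero_smul] at hfix
  exact hpow hfix.symm

/-- **The contractions `w(λ)` exhaust `H¹(A(ℂ); ℂ)`** when `h^{dim A} ≠ 0`: the linear map `λ ↦ w(λ)`,
`Dual H¹ → H¹`, is injective (`dual_eq_zero_of_contraction_eq_zero`) between spaces of the same finite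
dimension, hence surjective. [cite: LangeBirkenhake1992, §2.5] -/
theorem exists_contraction_eq (a : ι → ℂ) (u v : ι → complexBetti A.X 1)
    (hpow : cupPowTwo (∑ l, a l • cupProduct (rfl : 1 + 1 = 2) (u l) (v l)) A.dim ≠ 0)
    (x : complexBetti A.X 1) :
    ∃ lam : Module.Dual ℂ (complexBetti A.X 1), ∑ l, a l • (lam (v l) • u l - lam (u l) • v l) = x := by
  classical
  haveI : Module.Finite ℂ (complexBetti A.X 1) := abelianVarietyCohomologyExteriorH1_holds.finite_one A
  let W : Module.Dual ℂ (complexBetti A.X 1) →ₗ[ℂ] complexBetti A.X 1 :=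
    ∑ l, a l • ((Module.Dual.eval ℂ (complexBetti A.X 1) (v l)).smulRight (u l) -
      (Module.Dual.eval ℂ (complexBetti A.X 1) (u l)).smulRight (v l))
  have hW : ∀ lam, W lam = ∑ l, a l • (lam (v l) • u l - lam (u l) • v l) := by
    intro lam
    simp only [W, LinearMap.sum_apply, LinearMap.smul_apply, LinearMap.sub_apply,
      LinearMap.smulRight_apply, Module.Dual.eval_apply]
  have hinj : Function.Injective W := by
    rw [← LinearMap.ker_eq_bot, LinearMap.ker_eq_bot']
    intro lam hlam
    rw [hW] at hlam
    exact dual_eq_zero_of_contraction_eq_zero a u v hpow lam hlam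
  have hsurj : Function.Surjective W :=
    (LinearMap.injective_iff_surjective_of_finrank_eq_finrank Subspace.dual_finrank_eq).1 hinj
  obtain ⟨lam, hlam⟩ := hsurj x
  exact ⟨lam, by rw [← hW, hlam]⟩

end Nondegenerate

/-! ### Degree-two Lefschetz classes on `A × A` and the first member of a Künneth family -/

section DivisorClasses

variable {A : AbelianVariety ℂ} {ι : Type} [Fintype ι]
  {g : ∀ k : ℕ, complexBetti A.X k ≃ₗ[ℂ] complexBetti A.X k}
  {G : ∀ a k : ℕ, complexBetti (cartesianPow A.X (a + 1)) k ≃ₗ[ℂ] complexBetti (cartesianPow A.X (a + 1)) k}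
  {G1 : ∀ k : ℕ, complexBetti (A.X ⊗ A.X) k ≃ₗ[ℂ] complexBetti (A.X ⊗ A.X) k}

/-- Pull-back is multiplicative, in the `complexBetti` spelling (Hatcher Prop. 3.10, the tree's
`cupProduct_map`). [cite: HatcherAT2002, §3.2 Prop. 3.10] -/
private theorem cb_map_cup {X Y : SchemeOver ℂ} (f : X ⟶ Y) {p q n : ℕ} (hpq : p + q = n)
    (x : complexBetti Y p) (y : complexBetti Y q) :
    complexBetti.map f n (cupProduct hpq x y) =
      cupProduct hpq (complexBetti.map f p x) (complexBetti.map f q y) :=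
  cupProduct_map _ hpq x y

/-- `Δ^* pr₁^* = id` on `Hᵏ(A(ℂ); ℂ)` (`Δ = (𝟙, 𝟙) : A → A × A`). [folklore] -/
private theorem diag_map_fst (k : ℕ) (x : complexBetti A.X k) :
    complexBetti.map (CartesianMonoidalCategory.lift (𝟙 A.X) (𝟙 A.X)) k
      (complexBetti.map (fst A.X A.X) k x) = x := by
  rw [← ModuleCat.comp_apply, ← complexBetti.map_comp, CartesianMonoidalCategory.lift_fst,
    complexBetti.map_id, ModuleCat.id_apply]

/-- `Δ^* pr₂^* = id` on `Hᵏ(A(ℂ); ℂ)`. [folklore] -/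
private theorem diag_map_snd (k : ℕ) (x : complexBetti A.X k) :
    complexBetti.map (CartesianMonoidalCategory.lift (𝟙 A.X) (𝟙 A.X)) k
      (complexBetti.map (snd A.X A.X) k x) = x := by
  rw [← ModuleCat.comp_apply, ← complexBetti.map_comp, CartesianMonoidalCategory.lift_snd,
    complexBetti.map_id, ModuleCat.id_apply]

/-- `map_cross` of a Künneth family at the first power `A × A = A^{×2}`, read on `g = G₀` and the typed
copy `G₁` of `G 1`: `G₁(pr₁^* x ∪ pr₂^* y) = pr₁^* g x ∪ pr₂^* g y` (André 1996 §4.3: the diagonal action on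
`H(X) ⊗ H(X) ⊆ H(X × X)`). [cite: Andre1996Motifs, §4.3 (p. 22)] [cite: HatcherAT2002, §3.2 Thm. 3.16] -/
theorem kunneth_cross_one (hG : IsKunnethFamily A.X G) (h0 : G 0 = g) (h1 : G 1 = G1) (i j k : ℕ)
    (hij : i + j = k) (x : complexBetti A.X i) (y : complexBetti A.X j) :
    G1 k (cupProduct hij (complexBetti.map (fst A.X A.X) i x) (complexBetti.map (snd A.X A.X) j y)) =
      cupProduct hij (complexBetti.map (fst A.X A.X) i (g i x))
        (complexBetti.map (snd A.X A.X) j (g j y)) := by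
  have e := hG.map_cross 0 i j k hij x y
  rw [h0, h1] at e
  exact e

/-- **A rational `(1,1)`-class on `A × A` is a Lefschetz class of the power `A^{×2}`** (`D¹ = B¹`,
Lefschetz `(1,1)`: the tree's `mem_divisorClassesSpan_one`), hence FIXED by the member `G₁` of any
Künneth family fixing the Lefschetz classes on the powers. [cite: Milne1999LefschetzClasses, §4 Def. 4.3 and p. 657 (`D_hom(X)_k`)]
[cite: vanGeemen1994HodgeAV, §2.4] -/
theorem kunneth_one_apply_eq_self (h1 : G 1 = G1)
    (hfix : ∀ (a p : ℕ), ∀ x ∈ lefschetzPowClasses A.dim A.X a p, G a (2 * p) x = x)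
    {c : complexBetti (A.X ⊗ A.X) 2} (hQ : IsRationalClass c)
    (hc : IsOfHodgeType (A.dim + A.dim) (A.X ⊗ A.X) 2 1 1 c) : G1 2 c = c := by
  have hmem : c ∈ lefschetzPowClasses A.dim A.X 1 1 :=
    (mem_lefschetzPowClasses_iff 1 1 c).2 (mem_divisorClassesSpan_one hQ hc)
  have e := hfix 1 1 c hmem
  rw [h1] at e
  exact e

/-- **`F_φ^* = pr₁^* φ^* + pr₂^*` on `H¹`** for the homomorphism `F_φ = pr₁ ≫ φ + pr₂ : A × A → A`
(additivity of `f ↦ f^*` on `H¹` of abelian varieties, Lange–Birkenhake §1.1; the tree's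
`complexBetti_map_add_one`). [cite: LangeBirkenhake1992, §1.1 (p. 19)] -/
theorem map_fstCompAddSnd_one (φ : A ⟶ A) (z : complexBetti A.X 1) :
    complexBetti.map (X := A.X ⊗ A.X) (AbelianVariety.fst A A ≫ φ + AbelianVariety.snd A A).hom.hom.hom 1 z =
      complexBetti.map (fst A.X A.X) 1 (complexBetti.map φ.hom.hom.hom 1 z) +
        complexBetti.map (snd A.X A.X) 1 z := by
  change complexBetti.map (AbelianVariety.fst A A ≫ φ + AbelianVariety.snd A A).hom.hom.hom 1 z = _
  rw [complexBetti_map_add_one]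
  change ((complexBetti.map (AbelianVariety.fst A A ≫ φ).hom.hom.hom 1 +
    complexBetti.map (AbelianVariety.snd A A).hom.hom.hom 1).hom) z = _
  rw [ModuleCat.hom_add, LinearMap.add_apply]
  change complexBetti.map ((AbelianVariety.fst A A).hom.hom.hom ≫ φ.hom.hom.hom) 1 z +
    complexBetti.map (AbelianVariety.snd A A).hom.hom.hom 1 z = _
  rw [complexBetti.map_comp, ModuleCat.comp_apply]
  rfl

/-- **The divisor class `F^*h - pr₁^*φ^*h - pr₂^*h` of `A × A` computed on `H¹ ⊗ H¹`** (Mumford's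
`Λ(L) = m^*L ⊗ p₁^*L⁻¹ ⊗ p₂^*L⁻¹` for `φ = 𝟙`; Lange–Birkenhake §2.5): for a morphism `F : A × A → A`
acting on `H¹` as `F^* = pr₁^*φ^* + pr₂^*` (e.g. `F_φ = pr₁ ≫ φ + pr₂`, `map_fstCompAddSnd_one`) and
`x, y ∈ H¹(A(ℂ); ℂ)`:
`F^*(x ∪ y) - pr₁^*φ^*(x ∪ y) - pr₂^*(x ∪ y) = pr₁^*φ^*x ∪ pr₂^*y - pr₁^*φ^*y ∪ pr₂^*x`
(`f^*` multiplicative, graded commutativity in degree one). [cite: MumfordAV1970, §20 (definition of `Λ(L)`) and §1 (3)–(4)]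
[cite: HatcherAT2002, §3.2 Prop. 3.10 and Thm. 3.11] -/
theorem map_cupProduct_sub_sub_of_map_one (φ : A ⟶ A) {F : A.X ⊗ A.X ⟶ A.X}
    (hF : ∀ z : complexBetti A.X 1, complexBetti.map F 1 z =
      complexBetti.map (fst A.X A.X) 1 (complexBetti.map φ.hom.hom.hom 1 z) +
        complexBetti.map (snd A.X A.X) 1 z)
    (x y : complexBetti A.X 1) :
    complexBetti.map F 2 (cupProduct (rfl : 1 + 1 = 2) x y) -
      complexBetti.map (fst A.X A.X) 2
        (complexBetti.map φ.hom.hom.hom 2 (cupProduct (rfl : 1 + 1 = 2) x y)) -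
      complexBetti.map (snd A.X A.X) 2 (cupProduct (rfl : 1 + 1 = 2) x y) =
    cupProduct (rfl : 1 + 1 = 2)
        (complexBetti.map (fst A.X A.X) 1 (complexBetti.map φ.hom.hom.hom 1 x))
        (complexBetti.map (snd A.X A.X) 1 y) -
      cupProduct (rfl : 1 + 1 = 2)
        (complexBetti.map (fst A.X A.X) 1 (complexBetti.map φ.hom.hom.hom 1 y))
        (complexBetti.map (snd A.X A.X) 1 x) := by
  have hsx := cupProduct_gradedComm_holds ℂ (ComplexPoints (A.X ⊗ A.X)) (rfl : 1 + 1 = 2) rfl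
    (complexBetti.map (snd A.X A.X) 1 x)
    (complexBetti.map (fst A.X A.X) 1 (complexBetti.map φ.hom.hom.hom 1 y))
  simp only [mul_one, pow_one, neg_smul, one_smul] at hsx
  simp only [cb_map_cup, hF, map_add, LinearMap.add_apply]
  rw [hsx]
  abel

/-- The summed form: for `h = Σ_l a_l u_l ∪ v_l` and `F^* = pr₁^*φ^* + pr₂^*` on `H¹`,
`F^*h - pr₁^*φ^*h - pr₂^*h = Σ_l a_l (pr₁^*φ^*u_l ∪ pr₂^*v_l - pr₁^*φ^*v_l ∪ pr₂^*u_l)`.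
[cite: MumfordAV1970, §20] [cite: HatcherAT2002, §3.2 Prop. 3.10] -/
theorem map_sum_sub_sub_of_map_one (φ : A ⟶ A) {F : A.X ⊗ A.X ⟶ A.X}
    (hF : ∀ z : complexBetti A.X 1, complexBetti.map F 1 z =
      complexBetti.map (fst A.X A.X) 1 (complexBetti.map φ.hom.hom.hom 1 z) +
        complexBetti.map (snd A.X A.X) 1 z)
    (a : ι → ℂ) (u v : ι → complexBetti A.X 1) :
    complexBetti.map F 2 (∑ l, a l • cupProduct (rfl : 1 + 1 = 2) (u l) (v l)) -
      complexBetti.map (fst A.X A.X) 2 (complexBetti.map φ.hom.hom.hom 2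
        (∑ l, a l • cupProduct (rfl : 1 + 1 = 2) (u l) (v l))) -
      complexBetti.map (snd A.X A.X) 2 (∑ l, a l • cupProduct (rfl : 1 + 1 = 2) (u l) (v l)) =
    ∑ l, a l • (cupProduct (rfl : 1 + 1 = 2)
        (complexBetti.map (fst A.X A.X) 1 (complexBetti.map φ.hom.hom.hom 1 (u l)))
        (complexBetti.map (snd A.X A.X) 1 (v l)) -
      cupProduct (rfl : 1 + 1 = 2)
        (complexBetti.map (fst A.X A.X) 1 (complexBetti.map φ.hom.hom.hom 1 (v l)))
        (complexBetti.map (snd A.X A.X) 1 (u l))) := by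
  simp only [map_sum, map_smul, ← Finset.sum_sub_distrib, ← smul_sub]
  exact Finset.sum_congr rfl fun l _ ↦ by rw [map_cupProduct_sub_sub_of_map_one φ hF]

/-- **The cross-sum identity.** For `g` in the special Lefschetz group with Künneth family `G`
(`G₀ = g`, `G₁` its member on `A × A`, fixing the Lefschetz classes on the powers), a rational
`(1,1)`-class `h = Σ_l a_l u_l ∪ v_l` on `A` and `φ ∈ End(A)`: the class
`M_φ = F_φ^*h - pr₁^*φ^*h - pr₂^*h = Σ_l a_l (pr₁^*φ^*u_l ∪ pr₂^*v_l - pr₁^*φ^*v_l ∪ pr₂^*u_l)` of `A × A`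
is a combination of rational `(1,1)`-classes (pull-backs of `h` along morphisms of smooth projective
varieties), hence fixed by `G₁`, and `G₁` acts on cross products diagonally through `g`; so the cross sum
with `g` inserted everywhere equals the original one.
[cite: Milne1999LefschetzClasses, §4 Def. 4.3, Thm. 4.4 (proof) and p. 659] [cite: MumfordAV1970, §20] -/
theorem sum_cross_apply_eq_sum_cross (hG : IsKunnethFamily A.X G) (h0 : G 0 = g) (h1 : G 1 = G1)
    (hfix : ∀ (a p : ℕ), ∀ x ∈ lefschetzPowClasses A.dim A.X a p, G a (2 * p) x = x)
    {h : complexBetti A.X 2} (hQ : IsRationalClass h) (h11 : IsOfHodgeType A.dim A.X 2 1 1 h)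
    (a : ι → ℂ) (u v : ι → complexBetti A.X 1)
    (hh : h = ∑ l, a l • cupProduct (rfl : 1 + 1 = 2) (u l) (v l)) (φ : A ⟶ A) :
    ∑ s : ι ⊕ ι, cupProduct (rfl : 1 + 1 = 2)
        (complexBetti.map (fst A.X A.X) 1
          (Sum.elim (fun l ↦ a l • g 1 (complexBetti.map φ.hom.hom.hom 1 (u l)))
            (fun l ↦ -(a l • g 1 (complexBetti.map φ.hom.hom.hom 1 (v l)))) s))
        (complexBetti.map (snd A.X A.X) 1 (Sum.elim (fun l ↦ g 1 (v l)) (fun l ↦ g 1 (u l)) s)) =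
      ∑ s : ι ⊕ ι, cupProduct (rfl : 1 + 1 = 2)
        (complexBetti.map (fst A.X A.X) 1
          (Sum.elim (fun l ↦ a l • complexBetti.map φ.hom.hom.hom 1 (u l))
            (fun l ↦ -(a l • complexBetti.map φ.hom.hom.hom 1 (v l))) s))
        (complexBetti.map (snd A.X A.X) 1 (Sum.elim v u s)) := by
  have hX : IsSmoothProjective A.dim A.X := AbelianVariety.isSmoothProjective_holds (A := A)
  have hXX := IsSmoothProjective.tensor_holds hX hX
  -- the homomorphism `F_φ = pr₁ ≫ φ + pr₂ : A × A → A` as a morphism of schemes, and its action on `H¹`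
  obtain ⟨F, hFdef⟩ : ∃ F : A.X ⊗ A.X ⟶ A.X,
      F = (AbelianVariety.fst A A ≫ φ + AbelianVariety.snd A A).hom.hom.hom := ⟨_, rfl⟩
  have hF : ∀ z : complexBetti A.X 1, complexBetti.map F 1 z =
      complexBetti.map (fst A.X A.X) 1 (complexBetti.map φ.hom.hom.hom 1 z) +
        complexBetti.map (snd A.X A.X) 1 z := fun z ↦ by
    rw [hFdef]
    exact map_fstCompAddSnd_one φ z
  -- the right-hand side is `M_φ`
  have eR : (∑ s : ι ⊕ ι, cupProduct (rfl : 1 + 1 = 2)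
        (complexBetti.map (fst A.X A.X) 1
          (Sum.elim (fun l ↦ a l • complexBetti.map φ.hom.hom.hom 1 (u l))
            (fun l ↦ -(a l • complexBetti.map φ.hom.hom.hom 1 (v l))) s))
        (complexBetti.map (snd A.X A.X) 1 (Sum.elim v u s))) =
      complexBetti.map F 2 h - complexBetti.map (fst A.X A.X) 2 (complexBetti.map φ.hom.hom.hom 2 h) -
        complexBetti.map (snd A.X A.X) 2 h := by
    rw [hh, map_sum_sub_sub_of_map_one φ hF, Fintype.sum_sum_type]
    simp only [Sum.elim_inl, Sum.elim_inr, map_smul, map_neg, LinearMap.smul_apply,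
      LinearMap.neg_apply, Finset.sum_neg_distrib, ← sub_eq_add_neg, ← Finset.sum_sub_distrib,
      ← smul_sub]
  -- `M_φ` is fixed by `G₁`: its three terms are rational `(1,1)`-classes of `A × A`
  have hM : G1 2 (complexBetti.map F 2 h - complexBetti.map (fst A.X A.X) 2 (complexBetti.map φ.hom.hom.hom 2 h) -
        complexBetti.map (snd A.X A.X) 2 h) =
      complexBetti.map F 2 h - complexBetti.map (fst A.X A.X) 2 (complexBetti.map φ.hom.hom.hom 2 h) -
        complexBetti.map (snd A.X A.X) 2 h := by
    rw [map_sub, map_sub,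
      kunneth_one_apply_eq_self h1 hfix (hQ.pullback _) (h11.map_of_isSmoothProjective hXX hX F),
      kunneth_one_apply_eq_self h1 hfix ((hQ.pullback _).pullback _)
        ((h11.map_of_isSmoothProjective hX hX φ.hom.hom.hom).map_of_isSmoothProjective hXX hX
          (fst A.X A.X)),
      kunneth_one_apply_eq_self h1 hfix (hQ.pullback _)
        (h11.map_of_isSmoothProjective hXX hX (snd A.X A.X))]
  -- the left-hand side is `G₁ M_φ`
  have eL : (∑ s : ι ⊕ ι, cupProduct (rfl : 1 + 1 = 2)
        (complexBetti.map (fst A.X A.X) 1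
          (Sum.elim (fun l ↦ a l • g 1 (complexBetti.map φ.hom.hom.hom 1 (u l)))
            (fun l ↦ -(a l • g 1 (complexBetti.map φ.hom.hom.hom 1 (v l)))) s))
        (complexBetti.map (snd A.X A.X) 1 (Sum.elim (fun l ↦ g 1 (v l)) (fun l ↦ g 1 (u l)) s))) =
      G1 2 (∑ s : ι ⊕ ι, cupProduct (rfl : 1 + 1 = 2)
        (complexBetti.map (fst A.X A.X) 1
          (Sum.elim (fun l ↦ a l • complexBetti.map φ.hom.hom.hom 1 (u l))
            (fun l ↦ -(a l • complexBetti.map φ.hom.hom.hom 1 (v l))) s))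
        (complexBetti.map (snd A.X A.X) 1 (Sum.elim v u s))) := by
    rw [map_sum]
    refine Fintype.sum_congr _ _ fun s ↦ ?_
    rw [kunneth_cross_one hG h0 h1 1 1 2 (rfl : 1 + 1 = 2)]
    cases s with
    | inl l => simp only [Sum.elim_inl, map_smul]
    | inr l => simp only [Sum.elim_inr, map_neg, map_smul]
  rw [eL, eR, hM]

/-- **Commutation up to the contraction vectors.** In the situation of `sum_cross_apply_eq_sum_cross`,
comparing Künneth coefficients (`HodgeGroupExterior.sum_smul_eq_of_sum_cross_eq`, Hatcher Thm. 3.16)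
against a functional `λ` of the second factor gives, with `w(λ) = Σ_l a_l (λ(v_l) u_l - λ(u_l) v_l)`:
`g₁ φ^* w(λ ∘ g₁) = φ^* w(λ)`. [cite: Milne1999LefschetzClasses, Thm. 4.4 and p. 659]
[cite: HatcherAT2002, §3.2 Thm. 3.16] -/
theorem apply_map_contraction_eq (hG : IsKunnethFamily A.X G) (h0 : G 0 = g) (h1 : G 1 = G1)
    (hfix : ∀ (a p : ℕ), ∀ x ∈ lefschetzPowClasses A.dim A.X a p, G a (2 * p) x = x)
    (hn : 1 ≤ A.dim) {h : complexBetti A.X 2} (hQ : IsRationalClass h)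
    (h11 : IsOfHodgeType A.dim A.X 2 1 1 h) (a : ι → ℂ) (u v : ι → complexBetti A.X 1)
    (hh : h = ∑ l, a l • cupProduct (rfl : 1 + 1 = 2) (u l) (v l)) (φ : A ⟶ A)
    (lam : Module.Dual ℂ (complexBetti A.X 1)) :
    g 1 (complexBetti.map φ.hom.hom.hom 1
        (∑ l, a l • (lam (g 1 (v l)) • u l - lam (g 1 (u l)) • v l))) =
      complexBetti.map φ.hom.hom.hom 1 (∑ l, a l • (lam (v l) • u l - lam (u l) • v l)) := by
  have hX : IsSmoothProjective A.dim A.X := AbelianVariety.isSmoothProjective_holds (A := A)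
  have H := sum_cross_apply_eq_sum_cross hG h0 h1 hfix hQ h11 a u v hh φ
  have key := HodgeGroupExterior.sum_smul_eq_of_sum_cross_eq hX hX (rfl : 1 + 1 = 2) (by omega)
    _ _ _ _ H lam
  rw [Fintype.sum_sum_type, Fintype.sum_sum_type] at key
  simp only [Sum.elim_inl, Sum.elim_inr, map_sum, map_add, map_neg, map_smul, smul_add, smul_neg,
    smul_smul, Finset.sum_add_distrib, Finset.sum_neg_distrib, sub_eq_add_neg, mul_comm] at key ⊢
  exact key

/-- **`g` fixes the `2`-vector of `h`**: `Σ_l a_l g₁u_l ∪ g₁v_l = Σ_l a_l u_l ∪ v_l = h` (the cross-sum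
identity for `φ = 𝟙` pulled back along the diagonal `Δ : A → A × A`, `Δ^*(pr₁^*x ∪ pr₂^*y) = x ∪ y`,
and graded commutativity). [cite: Milne1999LefschetzClasses, Thm. 4.4 (proof: "(γ, γ†γ) fixes e_D")]
[cite: HatcherAT2002, §3.2 Thm. 3.11 and Thm. 3.16] -/
theorem sum_smul_cupProduct_apply_apply_eq (hG : IsKunnethFamily A.X G) (h0 : G 0 = g) (h1 : G 1 = G1)
    (hfix : ∀ (a p : ℕ), ∀ x ∈ lefschetzPowClasses A.dim A.X a p, G a (2 * p) x = x)
    {h : complexBetti A.X 2} (hQ : IsRationalClass h) (h11 : IsOfHodgeType A.dim A.X 2 1 1 h)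
    (a : ι → ℂ) (u v : ι → complexBetti A.X 1)
    (hh : h = ∑ l, a l • cupProduct (rfl : 1 + 1 = 2) (u l) (v l)) :
    ∑ l, a l • cupProduct (rfl : 1 + 1 = 2) (g 1 (u l)) (g 1 (v l)) =
      ∑ l, a l • cupProduct (rfl : 1 + 1 = 2) (u l) (v l) := by
  have H := sum_cross_apply_eq_sum_cross hG h0 h1 hfix hQ h11 a u v hh (𝟙 A)
  have hid : ∀ z : complexBetti A.X 1, complexBetti.map (𝟙 A : A ⟶ A).hom.hom.hom 1 z = z := by
    intro z
    change complexBetti.map (𝟙 A.X) 1 z = z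
    rw [complexBetti.map_id]
    rfl
  simp only [hid] at H
  have HΔ := congrArg (complexBetti.map (CartesianMonoidalCategory.lift (𝟙 A.X) (𝟙 A.X)) 2) H
  simp only [map_add, map_sum, map_smul, map_neg, cb_map_cup, diag_map_fst, diag_map_snd,
    Fintype.sum_sum_type, Sum.elim_inl, Sum.elim_inr, LinearMap.smul_apply, LinearMap.neg_apply] at HΔ
  have hswap : ∀ X Y : ι → complexBetti A.X 1,
      ∑ l, -(a l • cupProduct (rfl : 1 + 1 = 2) (Y l) (X l)) =
        ∑ l, a l • cupProduct (rfl : 1 + 1 = 2) (X l) (Y l) := by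
    intro X Y
    refine Finset.sum_congr rfl fun l _ ↦ ?_
    rw [cupProduct_gradedComm_holds ℂ (ComplexPoints A.X) (rfl : 1 + 1 = 2) rfl (Y l) (X l)]
    simp
  rw [hswap, hswap] at HΔ
  have e : (2 : ℂ) • ∑ l, a l • cupProduct (rfl : 1 + 1 = 2) (g 1 (u l)) (g 1 (v l)) =
      (2 : ℂ) • ∑ l, a l • cupProduct (rfl : 1 + 1 = 2) (u l) (v l) := by
    rw [two_smul, two_smul]
    exact HΔ
  exact smul_right_injective _ (two_ne_zero (α := ℂ)) e

end DivisorClasses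

/-! ### Theorem 4.4, the inclusion `ker l(A)(ℂ)|_{H¹} ⊆ S(A)(ℂ)` -/

section Main

variable {A : AbelianVariety ℂ} {ι : Type} [Fintype ι]
  {g : ∀ k : ℕ, complexBetti A.X k ≃ₗ[ℂ] complexBetti A.X k}

/-- The core of the proof, for a class `h = Σ_l a_l u_l ∪ v_l` written as a combination of cup products of
degree-one classes (every class of `H²(A(ℂ); ℂ) = ⋀²H¹` is), rational, of type `(1,1)`, with
`h^{dim A} ≠ 0`, `dim A ≥ 1`: **for `g` in the special Lefschetz group, `g₁ ∈ S(A)(ℂ)`** — `g₁` commutes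
with every `φ^*` (the contraction vectors `w(λ)` exhaust `H¹` and `g₁φ^*g₁⁻¹ w(λ) = φ^* w(λ)`) and preserves
`Q_h` (`⋀²g₁` fixes `h`, so `⋀g₁` fixes `h^{dim A - 1}` and `h^{dim A} ≠ 0`, whence `det g₁ = 1`, and
`Q_h(g₁x, g₁y) = ⋀^{2 dim A}g₁ (Q_h(x, y)) = det g₁ · Q_h(x, y)`).
[cite: Milne1999LefschetzClasses, Thm. 4.4 and p. 659 (`ker l(A) = S(A)`)] [cite: LangeBirkenhake1992, Lemma 1.1.17 and §2.5] -/
theorem apply_one_mem_unitaryCentralizerGroup_of_eq_sum (hn : 1 ≤ A.dim) {h : complexBetti A.X 2}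
    (hQ : IsRationalClass h) (h11 : IsOfHodgeType A.dim A.X 2 1 1 h) (hpow : cupPowTwo h A.dim ≠ 0)
    (a : ι → ℂ) (u v : ι → complexBetti A.X 1)
    (hh : h = ∑ l, a l • cupProduct (rfl : 1 + 1 = 2) (u l) (v l))
    (hg : g ∈ specialLefschetzGroup A.dim A.X) : g 1 ∈ unitaryCentralizerGroup A h := by
  obtain ⟨G, hG, h0, hfix⟩ := hg
  have hpow' : cupPowTwo (∑ l, a l • cupProduct (rfl : 1 + 1 = 2) (u l) (v l)) A.dim ≠ 0 := hh ▸ hpow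
  refine ⟨fun φ x ↦ ?_, fun x y ↦ ?_⟩
  · -- commutation with `φ^*`
    obtain ⟨μ, hμ⟩ := exists_contraction_eq a u v hpow' x
    set lam : Module.Dual ℂ (complexBetti A.X 1) := μ.comp (g 1).symm.toLinearMap with hlam_def
    have hlam : ∀ z, lam (g 1 z) = μ z := fun z ↦ by
      rw [hlam_def, LinearMap.comp_apply, LinearEquiv.coe_toLinearMap, LinearEquiv.symm_apply_apply]
    have k1 := apply_map_contraction_eq hG h0 rfl hfix hn hQ h11 a u v hh φ lam
    have k0 := apply_map_contraction_eq hG h0 rfl hfix hn hQ h11 a u v hh (𝟙 A) lam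
    have hid : ∀ z : complexBetti A.X 1, complexBetti.map (𝟙 A : A ⟶ A).hom.hom.hom 1 z = z := by
      intro z
      change complexBetti.map (𝟙 A.X) 1 z = z
      rw [complexBetti.map_id]
      rfl
    simp only [hlam, hμ] at k1 k0
    rw [hid, hid] at k0
    change g 1 (complexBetti.map φ.hom.hom.hom 1 x) = complexBetti.map φ.hom.hom.hom 1 (g 1 x)
    rw [k1, k0]
  · -- the polarization pairing
    have hΛ := AbelianVariety.hasExteriorCohomologyH1_complexPoints A
    have hU2 : exteriorPullback hΛ (g 1 : complexBetti A.X 1 →ₗ[ℂ] complexBetti A.X 1) 2 h = h := by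
      rw [hh, map_sum]
      simp_rw [map_smul, exteriorPullback_cupProduct_one_one, LinearEquiv.coe_coe]
      exact sum_smul_cupProduct_apply_apply_eq hG h0 rfl hfix hQ h11 a u v hh
    have hdet : LinearMap.det (g 1 : complexBetti A.X 1 →ₗ[ℂ] complexBetti A.X 1) = 1 := by
      have e := exteriorPullback_cupPowTwo hΛ hU2 A.dim
      rw [exteriorPullback_top hΛ _ (AbelianVariety.finrank_complexBetti_one A)] at e
      exact smul_left_injective ℂ hpow (e.trans (one_smul ℂ _).symm)
    have hxy : cupProduct (rfl : 1 + 1 = 2) (g 1 x) (g 1 y) =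
        exteriorPullback hΛ (g 1 : complexBetti A.X 1 →ₗ[ℂ] complexBetti A.X 1) 2
          (cupProduct (rfl : 1 + 1 = 2) x y) := by
      rw [exteriorPullback_cupProduct_one_one, LinearEquiv.coe_coe]
    rw [polarizationPairingOne_apply, polarizationPairingOne_apply, hxy,
      ← exteriorPullback_lefschetzPow hΛ hU2 2 _ (A.dim - 1),
      exteriorPullback_top hΛ _ (d := 2 + 2 * (A.dim - 1))
        (by rw [AbelianVariety.finrank_complexBetti_one]; omega), hdet, one_smul]

/-- In dimension `0`, `H¹(A(ℂ); ℂ) = 0` and every automorphism of it lies in `S(A)(ℂ)`. [folklore] -/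
private theorem mem_unitaryCentralizerGroup_of_dim_eq_zero (hA : A.dim = 0) (h : complexBetti A.X 2)
    (u : complexBetti A.X 1 ≃ₗ[ℂ] complexBetti A.X 1) : u ∈ unitaryCentralizerGroup A h := by
  haveI : Module.Finite ℂ (complexBetti A.X 1) := abelianVarietyCohomologyExteriorH1_holds.finite_one A
  have hV : Module.finrank ℂ (complexBetti A.X 1) = 0 := by
    rw [AbelianVariety.finrank_complexBetti_one, hA, mul_zero]
  haveI : Subsingleton (complexBetti A.X 1) := Module.finrank_zero_iff.1 hV
  have hu : ∀ x, u x = x := fun x ↦ Subsingleton.elim _ _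
  exact ⟨fun φ x ↦ by rw [hu, hu], fun x y ↦ by rw [hu, hu]⟩

/-- **Milne 1999, Theorem 4.4 — the inclusion `ker l(A)(ℂ) ⊆ S(A)(ℂ)`, read on `H¹`, PROVED on the
carriers.** For every complex abelian variety `A`, every polarization class `h` (rational, with `s · h`
Kähler for some real `s > 0`) and every `g` in the tree's special Lefschetz group
`specialLefschetzGroup (dim A) A.X` (the Künneth families FIXING all Lefschetz classes on all powers of
`A`, `Milne1999/LefschetzGroup`), the degree-one component `g₁` lies in
`S(A)(ℂ) = unitaryCentralizerGroup A h`: it commutes with `φ^*` for every `φ ∈ End(A)` and preserves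
the polarization pairing `Q_h(x, y) = h^{dim A - 1} ∪ x ∪ y`. This is the half "`⊆`" of the cited record
`Milne1999_thm44_specialLefschetzGroup_one_eq_unitaryCentralizerGroup` (`Milne1999/LefschetzCentraliser`), i.e.
Milne's "`L(A) ⊆ G(A)`" / "the kernel of `l(A)` […] equals `S(A)`" (p. 659) in one direction, on
`ℂ`-points. Milne derives it from Thm. 3.2 (invariant theory) and Chevalley's theorem; the proof here uses
only DEGREE-TWO Lefschetz classes on `A × A` — the divisor classes `F_φ^*h - pr₁^*φ^*h - pr₂^*h`,
`F_φ = pr₁ ≫ φ + pr₂` (Mumford's `Λ(L)`, §20) — Künneth uniqueness, and `H•(A(ℂ); ℂ) = ⋀•H¹`; no graph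
classes (Cor. 5.6) and no Néron–Severi dictionary are needed. The reverse inclusion (every `u ∈ S(A)(ℂ)`
extends to a Künneth family fixing all Lefschetz classes on all powers) remains cited.
[cite: Milne1999LefschetzClasses, Thm. 4.4 and p. 659 (`ker l(A) = S(A)`), §1 p. 644 (definition of `S(A)`)]
[cite: MumfordAV1970, §20] [cite: LangeBirkenhake1992, Lemma 1.1.17 and §2.5] -/
theorem apply_one_mem_unitaryCentralizerGroup_of_mem_specialLefschetzGroup {h : complexBetti A.X 2}
    (hQ : IsRationalClass h) (hK : ∃ s : ℝ, 0 < s ∧ IsKaehlerClass A.dim A.X ((s : ℂ) • h))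
    (hg : g ∈ specialLefschetzGroup A.dim A.X) : g 1 ∈ unitaryCentralizerGroup A h := by
  obtain ⟨s, hs, hK⟩ := hK
  rcases Nat.eq_zero_or_pos A.dim with hA | hn
  · exact mem_unitaryCentralizerGroup_of_dim_eq_zero hA h (g 1)
  have hX : IsSmoothProjective A.dim A.X := AbelianVariety.isSmoothProjective_holds (A := A)
  have h11 : IsOfHodgeType A.dim A.X 2 1 1 h := by
    have e := (hK.isOfHodgeType_one_one).smul ((s : ℂ)⁻¹)
    rwa [smul_smul, inv_mul_cancel₀ (Complex.ofReal_ne_zero.2 hs.ne'), one_smul] at e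
  have hpow : cupPowTwo h A.dim ≠ 0 := by
    intro h0
    have e := hK.cupPowTwo_ne_zero hX (p := A.dim) hn le_rfl
    rw [cupPowTwo_smul, h0, smul_zero] at e
    exact e rfl
  -- `h` is a combination of cup products of degree-one classes (`H² = ⋀²H¹`)
  have hmem : h ∈ Submodule.span ℂ (Set.range (cupPowOne ℂ (ComplexPoints A.X) 2)) := by
    rw [abelianVarietyCohomologyExteriorH1_holds.span_range_cupPowOne A 2]
    exact Submodule.mem_top
  obtain ⟨c, hc⟩ := (Finsupp.mem_span_range_iff_exists_finsupp.1 hmem)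
  have hh : h = ∑ l : c.support, c l • cupProduct (rfl : 1 + 1 = 2)
      ((l : Fin 2 → complexBetti A.X 1) 0) ((l : Fin 2 → complexBetti A.X 1) 1) := by
    rw [← hc, Finsupp.sum, ← Finset.sum_coe_sort]
    refine Finset.sum_congr rfl fun l _ ↦ ?_
    rw [cupPowOne_succ, cupPowOne_one]
    rfl
  exact apply_one_mem_unitaryCentralizerGroup_of_eq_sum hn hQ h11 hpow _ _ _ hh hg

/-- **The inclusion of Thm. 4.4 as an inequality of subgroups of `GL(H¹(A(ℂ); ℂ))`**:
`{g₁ | g ∈ specialLefschetzGroup (dim A) A.X} ≤ S(A)(ℂ) = unitaryCentralizerGroup A h` for every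
polarization class `h` — one half of the cited record
`Milne1999_thm44_specialLefschetzGroup_one_eq_unitaryCentralizerGroup`, which asserts equality.
[cite: Milne1999LefschetzClasses, Thm. 4.4 and p. 659] -/
theorem specialLefschetzGroup_map_one_le_unitaryCentralizerGroup (A : AbelianVariety ℂ)
    {h : complexBetti A.X 2} (hQ : IsRationalClass h)
    (hK : ∃ s : ℝ, 0 < s ∧ IsKaehlerClass A.dim A.X ((s : ℂ) • h)) :
    (specialLefschetzGroup A.dim A.X).map
        (Pi.evalMonoidHom (fun k : ℕ ↦ complexBetti A.X k ≃ₗ[ℂ] complexBetti A.X k) 1) ≤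
      unitaryCentralizerGroup A h := by
  rintro _ ⟨g, hg, rfl⟩
  exact apply_one_mem_unitaryCentralizerGroup_of_mem_specialLefschetzGroup hQ hK hg

/-- **`{g₁ | g ∈ specialLefschetzGroup (dim A) A.X} ≤ (C(A) ⊗ ℂ)^×` unconditionally**: the degree-one
component of an element of the special Lefschetz group commutes with every `φ^*`, `φ ∈ End(A)` (apply the
theorem to the rational Kähler class of a projective embedding, `KaehlerRationalDatum`).
[cite: Milne1999LefschetzClasses, Thm. 4.4 and §1 p. 642 (`C(A)`)] [cite: VoisinHodgeI2002, §7.1.2 and Thm. 7.10] -/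
theorem specialLefschetzGroup_map_one_le_centralizerGroup (A : AbelianVariety ℂ) :
    (specialLefschetzGroup A.dim A.X).map
        (Pi.evalMonoidHom (fun k : ℕ ↦ complexBetti A.X k ≃ₗ[ℂ] complexBetti A.X k) 1) ≤
      centralizerGroup A := by
  obtain ⟨D⟩ := nonempty_kaehlerRationalDatum (AbelianVariety.isSmoothProjective_holds (A := A))
  have hK : ∃ s : ℝ, 0 < s ∧ IsKaehlerClass A.dim A.X ((s : ℂ) • D.Hη) :=
    ⟨1, one_pos, by
      rw [Complex.ofReal_one, one_smul]
      exact D.isKaehlerClassVia.isKaehlerClass D.isNatural D.isMultiplicative⟩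
  exact (specialLefschetzGroup_map_one_le_unitaryCentralizerGroup A D.isRationalClass_Hη hK).trans
    unitaryCentralizerGroup_le_centralizerGroup

end Main

end Literature.AlgebraicGeometry.Milne1999

end
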